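import Literature.Analysis.FluidPDE.CheskidovShvydkoyAssembly
import Literature.Analysis.FluidPDE.CheskidovDaiCut
import Literature.Analysis.FluidPDE.CheskidovDaiGronwall
import HarnessLib

/-!
# The Cheskidov–Dai bootstrap on a covered interval: `f ≤ F_max` from the occupation hypothesis

Analysis/FluidPDE support file (serves the discharge of the named fact
`Literature.Analysis.FluidPDE.cheskidov_dai_occupation_regular` — Cheskidov–Dai, arXiv:1507.06611 =
Proc. Edinburgh Math. Soc. (2025), Thm. 1.1). This is the quantitative heart of §3.1 of the paper, in the
tree's `H¹` dyadic language. On an interval `[s₁, b] ⊂ (T/2, T)` along which the dyadic energy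
`f(t) = F(u(t)).toReal` of a Leray–Hopf solution satisfies the two-point inequality with the low-mode
rate `ω(s,t) = 2 (B_f ∫⁻_{(s,t]} f_{J(τ)}(u(τ)) dτ).toReal` (`J(τ)` the top saturated level at threshold
`c ν`), the Grönwall lemma with a variable rate (`CheskidovDaiGronwall`) gives
`f(t) ≤ 2 f(s₁) 4^{ω(s₁,t)}`; the split of the low-mode factor at a fixed level `q*`
(`CheskidovDaiCut.lowSum_le_lowSum_add_sum_occupation`), the occupation hypothesis
`∫_{T/2}^T 1_{q ≤ Q(τ)} λ_q ‖u_q‖_∞ dτ ≤ 2c` for `q > q*`, and the control of the top level by the energy,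
`2^{Q̄} ≲ S/(cν)²` with `S = sup_{[s₁,b]} f` (Cheskidov–Dai (3.9)–(3.10): "`Λ̄(t)^{ε} ≲ sup ‖u‖_{H^s}`"), turn
this into `f ≤ A₁ (1 + C_R S)^{8 B_f c}`; for `16 B_f c ≤ 1` the exponent is at most `1/2` and the
self-improving inequality `S ≤ A₁ + A₁ √(C_R S)` closes: `S ≤ F_max := 2A₁ + A₁² C_R`
(`dyadicF_toReal_le_of_covered`). The file also chains two-point inequalities with a variable rate
over overlapping intervals (`two_point_chain`).

## References

* A. Cheskidov, M. Dai, arXiv:1507.06611 = Proc. Edinburgh Math. Soc. (2025), §3.1, (3.8)–(3.10) and the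
  closing paragraph. [CheskidovDai2015]
-/

noncomputable section

open MeasureTheory Filter Topology Function Set
open Literature.Analysis.FunctionSpaces
open scoped ENNReal NNReal RealInnerProductSpace

namespace Literature.Analysis.FluidPDE

/-! ## Chaining two-point inequalities with a variable rate -/

section Chain

/-- **Chaining** over overlapping intervals `[a, b]`, `[c, d]` (`c ≤ b ≤ d`): if
`f(t) ≤ f(s) + ω(s,t) sup_{[s,t]} f` on each, `ω ≥ 0` is superadditive and `f` is bounded above on
`[a, d]`, the inequality holds on `[a, d]`. [cite: CheskidovDai2015, §3.1 (Grönwall step)] -/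
theorem two_point_chain {f : ℝ → ℝ} {ω : ℝ → ℝ → ℝ} {a b c d B : ℝ}
    (h₁ : ∀ s ∈ Icc a b, ∀ t ∈ Icc s b, f t ≤ f s + ω s t * sSup (f '' Icc s t))
    (h₂ : ∀ s ∈ Icc c d, ∀ t ∈ Icc s d, f t ≤ f s + ω s t * sSup (f '' Icc s t))
    (hcb : c ≤ b) (hbd : b ≤ d) (hω0 : ∀ s t, a ≤ s → s ≤ t → t ≤ d → 0 ≤ ω s t)
    (hωadd : ∀ s t u, a ≤ s → s ≤ t → t ≤ u → u ≤ d → ω s t + ω t u ≤ ω s u)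
    (hf0 : ∀ τ ∈ Icc a d, 0 ≤ f τ) (hB : ∀ τ ∈ Icc a d, f τ ≤ B) :
    ∀ s ∈ Icc a d, ∀ t ∈ Icc s d, f t ≤ f s + ω s t * sSup (f '' Icc s t) := by
  intro s hs t ht
  by_cases htb : t ≤ b
  · exact h₁ s ⟨hs.1, ht.1.trans htb⟩ t ⟨ht.1, htb⟩
  push Not at htb
  by_cases hsc : c ≤ s
  · exact h₂ s ⟨hsc, hs.2⟩ t ⟨ht.1, ht.2⟩
  push Not at hsc
  -- `s < c ≤ b < t`: go through `b`
  have hbdd : BddAbove (f '' Icc s t) := ⟨B, by rintro _ ⟨τ, hτ, rfl⟩; exact hB τ ⟨hs.1.trans hτ.1, hτ.2.trans ht.2⟩⟩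
  have hsb : s ≤ b := hsc.le.trans hcb
  have hsup1 : sSup (f '' Icc s b) ≤ sSup (f '' Icc s t) :=
    csSup_le_csSup hbdd ⟨f s, s, ⟨le_rfl, hsb⟩, rfl⟩ (image_mono (Icc_subset_Icc le_rfl htb.le))
  have hsup2 : sSup (f '' Icc b t) ≤ sSup (f '' Icc s t) :=
    csSup_le_csSup hbdd ⟨f b, b, ⟨le_rfl, htb.le⟩, rfl⟩ (image_mono (Icc_subset_Icc hsb le_rfl))
  have hS0 : 0 ≤ sSup (f '' Icc s t) :=
    (hf0 s ⟨hs.1, hs.2⟩).trans (le_csSup hbdd ⟨s, ⟨le_rfl, ht.1⟩, rfl⟩)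
  have e1 := h₁ s ⟨hs.1, hsb⟩ b ⟨hsb, le_rfl⟩
  have e2 := h₂ b ⟨hcb, hbd⟩ t ⟨htb.le, ht.2⟩
  have hω1 := hω0 s b hs.1 hsb hbd
  have hω2 := hω0 b t (hs.1.trans hsb) htb.le ht.2
  have hadd := hωadd s b t hs.1 hsb htb.le ht.2
  calc f t ≤ f b + ω b t * sSup (f '' Icc b t) := e2
    _ ≤ (f s + ω s b * sSup (f '' Icc s b)) + ω b t * sSup (f '' Icc b t) := by linarith
    _ ≤ (f s + ω s b * sSup (f '' Icc s t)) + ω b t * sSup (f '' Icc s t) := by gcongr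
    _ = f s + (ω s b + ω b t) * sSup (f '' Icc s t) := by ring
    _ ≤ f s + ω s t * sSup (f '' Icc s t) := by gcongr

/-- **The interval functional of a bounded rate.** For `F_J ≤ M < ∞` on `[a, b]` and `B_f < ∞`, the
functional `ω(s,t) = 2 (B_f ∫⁻_{(s,t]} F_J).toReal` is nonnegative, additive, Lipschitz in `t`, and
vanishes on the diagonal — the hypotheses of `le_two_mul_rpow_of_two_point`. [cite: CheskidovDai2015, §3.1 (Grönwall step)] -/
theorem omega_props {FJ : ℝ → ℝ≥0∞} {a b : ℝ} {M Bf : ℝ≥0∞} (hM : M ≠ ∞) (hBf : Bf ≠ ∞)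
    (hFJ : ∀ τ ∈ Icc a b, FJ τ ≤ M) :
    (∀ s t, a ≤ s → s ≤ t → t ≤ b → 0 ≤ 2 * (Bf * ∫⁻ τ in Ioc s t, FJ τ).toReal) ∧
    (∀ s t u, a ≤ s → s ≤ t → t ≤ u → u ≤ b →
      2 * (Bf * ∫⁻ τ in Ioc s t, FJ τ).toReal + 2 * (Bf * ∫⁻ τ in Ioc t u, FJ τ).toReal =
        2 * (Bf * ∫⁻ τ in Ioc s u, FJ τ).toReal) ∧
    (∀ s, a ≤ s → s ≤ b → ContinuousOn (fun t => 2 * (Bf * ∫⁻ τ in Ioc s t, FJ τ).toReal) (Icc s b)) ∧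
    (∀ s, 2 * (Bf * ∫⁻ τ in Ioc s s, FJ τ).toReal = 0) := by
  set ω : ℝ → ℝ → ℝ := fun s t => 2 * (Bf * ∫⁻ τ in Ioc s t, FJ τ).toReal with hω
  have hWle : ∀ s t, a ≤ s → s ≤ t → t ≤ b → ∫⁻ τ in Ioc s t, FJ τ ≤ M * ENNReal.ofReal (t - s) := by
    intro s t hs hst ht'
    calc ∫⁻ τ in Ioc s t, FJ τ ≤ ∫⁻ _ in Ioc s t, M :=
          setLIntegral_mono' measurableSet_Ioc fun τ hτ => hFJ τ ⟨hs.trans hτ.1.le, hτ.2.trans ht'⟩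
      _ = M * ENNReal.ofReal (t - s) := by rw [setLIntegral_const, Real.volume_Ioc, mul_comm]
  have hWtop : ∀ s t, a ≤ s → s ≤ t → t ≤ b → ∫⁻ τ in Ioc s t, FJ τ ≠ ∞ := fun s t hs hst ht' =>
    ne_top_of_le_ne_top (ENNReal.mul_ne_top hM ENNReal.ofReal_ne_top) (hWle s t hs hst ht')
  have hω0 : ∀ s t, a ≤ s → s ≤ t → t ≤ b → 0 ≤ ω s t := fun s t _ _ _ => by positivity
  have hωeq : ∀ s t u, a ≤ s → s ≤ t → t ≤ u → u ≤ b → ω s t + ω t u = ω s u := by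
    intro s t u hs hst htu hu
    simp only [hω]
    rw [← mul_add, ← ENNReal.toReal_add (ENNReal.mul_ne_top hBf (hWtop s t hs hst (htu.trans hu)))
      (ENNReal.mul_ne_top hBf (hWtop t u (hs.trans hst) htu hu)), ← mul_add,
      ← lintegral_union measurableSet_Ioc (Ioc_disjoint_Ioc_of_le le_rfl), Ioc_union_Ioc_eq_Ioc hst htu]
  set C : ℝ := 2 * (Bf.toReal * M.toReal) with hC
  have hC0 : 0 ≤ C := by positivity
  have hωle : ∀ s t, a ≤ s → s ≤ t → t ≤ b → ω s t ≤ C * (t - s) := by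
    intro s t hs hst ht'
    simp only [hω, hC]
    rw [ENNReal.toReal_mul]
    have := ENNReal.toReal_mono (ENNReal.mul_ne_top hM ENNReal.ofReal_ne_top) (hWle s t hs hst ht')
    rw [ENNReal.toReal_mul, ENNReal.toReal_ofReal (sub_nonneg.2 hst)] at this
    calc 2 * (Bf.toReal * (∫⁻ τ in Ioc s t, FJ τ).toReal) ≤ 2 * (Bf.toReal * (M.toReal * (t - s))) := by gcongr
      _ = 2 * (Bf.toReal * M.toReal) * (t - s) := by ring
  have hωcont : ∀ s, a ≤ s → s ≤ b → ContinuousOn (ω s) (Icc s b) := by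
    intro s hs hs2
    have hdiff : ∀ t' ∈ Icc s b, ∀ t'' ∈ Icc s b, |ω s t'' - ω s t'| ≤ C * |t'' - t'| := by
      intro t' ht' t'' ht''
      rcases le_total t' t'' with hle | hle
      · have heq := hωeq s t' t'' hs ht'.1 hle ht''.2
        have h1 := hω0 t' t'' (hs.trans ht'.1) hle ht''.2
        have h2 := hωle t' t'' (hs.trans ht'.1) hle ht''.2
        rw [abs_of_nonneg (by linarith), abs_of_nonneg (sub_nonneg.2 hle)]
        linarith
      · have heq := hωeq s t'' t' hs ht''.1 hle ht'.2
        have h1 := hω0 t'' t' (hs.trans ht''.1) hle ht'.2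
        have h2 := hωle t'' t' (hs.trans ht''.1) hle ht'.2
        rw [abs_of_nonpos (by linarith), abs_of_nonpos (sub_nonpos.2 hle)]
        linarith
    rw [Metric.continuousOn_iff]
    intro t' ht' ε hε
    refine ⟨ε / (C + 1), div_pos hε (by positivity), fun t'' ht'' hd => ?_⟩
    rw [Real.dist_eq] at hd ⊢
    calc |ω s t'' - ω s t'| ≤ C * |t'' - t'| := hdiff t' ht' t'' ht''
      _ ≤ (C + 1) * |t'' - t'| := by gcongr; linarith
      _ < (C + 1) * (ε / (C + 1)) := by gcongr
      _ = ε := by field_simp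
  have hω00 : ∀ s, ω s s = 0 := by intro s; simp [hω]
  exact ⟨hω0, hωeq, hωcont, hω00⟩

end Chain

/-! ## The quantitative bootstrap on a covered interval -/

section Covered

open LPBounds

variable {ν T : ℝ} {u₀ : EuclideanSpace ℝ (Fin 3) → EuclideanSpace ℝ (Fin 3)}
  {u : ℝ → EuclideanSpace ℝ (Fin 3) → EuclideanSpace ℝ (Fin 3)}

/-- **The top level against the enstrophy, real form** (Cheskidov–Dai (3.9) at `s = 1`): if level `j` of
a smooth `L²` slice with finite dyadic energy is saturated at threshold `c ν > 0`, then
`2^j ≤ (20 C_∞)² F / (cν)²`. [cite: CheskidovDai2015, §3.1 (3.9)] -/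
theorem two_pow_le_of_isSaturatedLevel (K : LPBounds (Fin 3)) {c ν : ℝ} (hcν : 0 < c * ν)
    {w : EuclideanSpace ℝ (Fin 3) → EuclideanSpace ℝ (Fin 3)} (hw : IsSmoothL2Field w) (hF : dyadicF w ≠ ∞)
    {j : ℕ} (hj : IsSaturatedLevel c ν w j) :
    (2 : ℝ) ^ j ≤ (20 * K.Cinf) ^ 2 * (dyadicF w).toReal / (c * ν) ^ 2 := by
  have h := ofReal_mul_two_pow_le_of_isSaturatedLevel K hw hj
  have h2ne : (2 : ℝ≥0∞) ≠ 0 := two_ne_zero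
  have h2top : (2 : ℝ≥0∞) ≠ ∞ := ENNReal.ofNat_ne_top
  have hd : (Module.finrank ℝ (EuclideanSpace ℝ (Fin 3)) : ℝ) = 3 := by rw [finrank_euclideanSpace, Fintype.card_fin]; norm_num
  rw [hd] at h
  have hpow : (2 : ℝ≥0∞) ^ (((j : ℤ) : ℝ) * 3 * 2⁻¹) * (2 : ℝ≥0∞) ^ (-(j : ℤ)) = (2 : ℝ≥0∞) ^ ((j : ℝ) / 2) := by
    rw [← ENNReal.rpow_intCast, ← ENNReal.rpow_add _ _ h2ne h2top]
    congr 1; push_cast; ring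
  have hj2 : (2 : ℝ≥0∞) ^ (j : ℕ) = (2 : ℝ≥0∞) ^ ((j : ℝ) / 2) * (2 : ℝ≥0∞) ^ ((j : ℝ) / 2) := by
    rw [← ENNReal.rpow_add _ _ h2ne h2top, ← ENNReal.rpow_natCast]; congr 1; ring
  have h' : ENNReal.ofReal (c * ν) * ((2 : ℝ≥0∞) ^ ((j : ℝ) / 2) * (2 : ℝ≥0∞) ^ ((j : ℝ) / 2)) ≤
      20 * (K.Cinf * dyadicF w ^ (1 / 2 : ℝ)) * (2 : ℝ≥0∞) ^ ((j : ℝ) / 2) := by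
    rw [← hj2]
    calc ENNReal.ofReal (c * ν) * (2 : ℝ≥0∞) ^ (j : ℕ)
        ≤ 20 * (K.Cinf * (2 : ℝ≥0∞) ^ (((j : ℤ) : ℝ) * 3 * 2⁻¹) * ((2 : ℝ≥0∞) ^ (-(j : ℤ)) * dyadicF w ^ (1 / 2 : ℝ))) := h
      _ = 20 * (K.Cinf * dyadicF w ^ (1 / 2 : ℝ)) * ((2 : ℝ≥0∞) ^ (((j : ℤ) : ℝ) * 3 * 2⁻¹) * (2 : ℝ≥0∞) ^ (-(j : ℤ))) := by ring
      _ = 20 * (K.Cinf * dyadicF w ^ (1 / 2 : ℝ)) * (2 : ℝ≥0∞) ^ ((j : ℝ) / 2) := by rw [hpow]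
  have hq0 : (2 : ℝ≥0∞) ^ ((j : ℝ) / 2) ≠ 0 := (ENNReal.rpow_pos (by norm_num) h2top).ne'
  have hqtop : (2 : ℝ≥0∞) ^ ((j : ℝ) / 2) ≠ ∞ := ENNReal.rpow_ne_top_of_nonneg (by positivity) h2top
  have h3 : ENNReal.ofReal (c * ν) * (2 : ℝ≥0∞) ^ ((j : ℝ) / 2) ≤ 20 * (K.Cinf * dyadicF w ^ (1 / 2 : ℝ)) := by
    rw [← mul_assoc] at h'
    exact (ENNReal.mul_le_mul_iff_left hq0 hqtop).1 h'
  -- pass to the reals and square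
  have hfin : 20 * (K.Cinf * dyadicF w ^ (1 / 2 : ℝ)) ≠ ∞ :=
    ENNReal.mul_ne_top (by norm_num) (ENNReal.mul_ne_top ENNReal.coe_ne_top (ENNReal.rpow_ne_top_of_nonneg (by norm_num) hF))
  have h4 := ENNReal.toReal_mono hfin h3
  rw [ENNReal.toReal_mul, ENNReal.toReal_ofReal hcν.le, ENNReal.toReal_mul, ENNReal.toReal_mul, ENNReal.coe_toReal,
    ← ENNReal.toReal_rpow, ← ENNReal.toReal_rpow, ENNReal.toReal_ofNat, ENNReal.toReal_ofNat] at h4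
  -- `h4 : c ν 2^{j/2} ≤ 20 (C_∞ F^{1/2})`
  have hsq : ((2 : ℝ) ^ ((j : ℝ) / 2)) ^ 2 = (2 : ℝ) ^ j := by
    rw [← Real.rpow_natCast ((2 : ℝ) ^ ((j : ℝ) / 2)) 2, ← Real.rpow_mul (by norm_num)]
    norm_num
  have hFsq : ((dyadicF w).toReal ^ (1 / 2 : ℝ)) ^ 2 = (dyadicF w).toReal := by
    rw [← Real.rpow_natCast ((dyadicF w).toReal ^ (1 / 2 : ℝ)) 2, ← Real.rpow_mul ENNReal.toReal_nonneg]
    norm_num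
  rw [le_div_iff₀ (by positivity)]
  have h5 : 0 ≤ c * ν * (2 : ℝ) ^ ((j : ℝ) / 2) := by positivity
  calc (2 : ℝ) ^ j * (c * ν) ^ 2 = (c * ν * (2 : ℝ) ^ ((j : ℝ) / 2)) ^ 2 := by rw [← hsq]; ring
    _ ≤ (20 * (K.Cinf * (dyadicF w).toReal ^ (1 / 2 : ℝ))) ^ 2 := pow_le_pow_left₀ h5 h4 2
    _ = (20 * K.Cinf) ^ 2 * (dyadicF w).toReal := by rw [mul_pow, mul_pow, hFsq]; ring

/-- The dissipation wavenumber of a slice with an a.e. smooth `L²` representative is finite.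
[cite: CheskidovDai2015, §3 (definition of Λ)] -/
theorem dissipationWavenumber_lt_top_of_rep (K : LPBounds (Fin 3)) {c ν : ℝ} (hcν : 0 < c * ν)
    {uτ w : EuclideanSpace ℝ (Fin 3) → EuclideanSpace ℝ (Fin 3)} (hw : IsSmoothL2Field w) (hae : uτ =ᵐ[volume] w) :
    dissipationWavenumber c ν uτ < ∞ := by
  rw [dissipationWavenumber_congr_ae hae, dissipationWavenumber_lt_top_iff]
  have hF : dyadicF w ≠ ∞ := by rw [← dyadicF_congr_ae hae]; exact dyadicF_ne_top_of_rep K hw hae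
  obtain ⟨N, hN⟩ := exists_nat_gt ((20 * K.Cinf) ^ 2 * (dyadicF w).toReal / (c * ν) ^ 2)
  refine ⟨N, fun j hj hsat => ?_⟩
  have h1 := two_pow_le_of_isSaturatedLevel K hcν hw hF hsat
  have h2 : (N : ℝ) < j := by exact_mod_cast hj
  have h3 : (j : ℝ) < (2 : ℝ) ^ j := by exact_mod_cast Nat.lt_two_pow_self
  linarith

/-- `√(1 + x) ≤ 1 + √x` for `x ≥ 0`. [folklore] -/
private theorem sqrt_one_add_le {x : ℝ} (hx : 0 ≤ x) : Real.sqrt (1 + x) ≤ 1 + Real.sqrt x := by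
  rw [Real.sqrt_le_iff]
  refine ⟨by positivity, ?_⟩
  nlinarith [Real.sq_sqrt hx, Real.sqrt_nonneg x]

/-- **The bootstrap on a covered interval** (Cheskidov–Dai §3.1, closing argument). Let `u` be Leray–Hopf
on `[0,T)`, `ν, c > 0`, `16 B_f c ≤ 1`, and let the occupation integrals satisfy
`∫⁻_{(T/2,T)} 1_{2^q ≤ Λ(u τ)} 2^q ‖Δ̇_q u(τ)‖_∞ dτ ≤ 2c` for `q > q*`, with the low sums below `q*` bounded
by `M* < ∞`. On an interval `[s₁, b] ⊂ [T/2, T)` where the dyadic energy `f = F(u(·)).toReal` satisfies the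
two-point inequality with the low-mode functional, is bounded, the slices have smooth representatives,
the occupation integrands are a.e.-measurable and the low-mode factors are bounded, one has
`f ≤ F_max := 2A + A² C_R` with `A = 2 f(s₁) 4^{2 B_f M* T}` and `C_R = (20 C_∞)²/(cν)²` — a bound which does
not depend on `b`. [cite: CheskidovDai2015, §3.1 (3.10) and the closing paragraph] -/
theorem dyadicF_toReal_le_of_covered (K : LPBounds (Fin 3)) (hν : 0 < ν) (hT : 0 < T)
    {c : ℝ} (hc : 0 < c) {Bf : ℝ≥0∞} (hBf : Bf ≠ ∞) (hθ : 16 * Bf.toReal * c ≤ 1)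
    {qs : ℕ} (hocc : ∀ q : ℕ, qs < q →
      ∫⁻ τ in Ioo (T / 2) T, {τ' : ℝ | (2 : ℝ≥0∞) ^ q ≤ dissipationWavenumber c ν (u τ')}.indicator
        (fun τ' => (2 : ℝ≥0∞) ^ q * eLpNorm (blockFn (q : ℤ) (u τ')) ∞ volume) τ ≤ ENNReal.ofReal (2 * c))
    {Mstar : ℝ≥0∞} (hMstar_top : Mstar ≠ ∞)
    (hMstar : ∀ τ ∈ Icc 0 T, ∑' n : ℕ, (2 : ℝ≥0∞) ^ ((qs : ℤ) - n) * blockSup (u τ) ((qs : ℤ) - n) ≤ Mstar)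
    {s₁ b : ℝ} (hs₁ : T / 2 ≤ s₁) (hs₁b : s₁ ≤ b) (hbT : b < T)
    (h2p : ∀ s ∈ Icc s₁ b, ∀ t ∈ Icc s b, (dyadicF (u t)).toReal ≤ (dyadicF (u s)).toReal +
      2 * (Bf * ∫⁻ τ in Ioc s t, ∑' n : ℕ, (2 : ℝ≥0∞) ^ (((sSup {j : ℕ | IsSaturatedLevel c ν (u τ) j} : ℕ) : ℤ) - n) *
        blockSup (u τ) (((sSup {j : ℕ | IsSaturatedLevel c ν (u τ) j} : ℕ) : ℤ) - n)).toReal *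
      sSup ((fun τ => (dyadicF (u τ)).toReal) '' Icc s t))
    (hB : ∃ B : ℝ, ∀ τ ∈ Icc s₁ b, (dyadicF (u τ)).toReal ≤ B)
    (hrep : ∀ τ ∈ Icc s₁ b, ∃ w : EuclideanSpace ℝ (Fin 3) → EuclideanSpace ℝ (Fin 3), IsSmoothL2Field w ∧ u τ =ᵐ[volume] w)
    (hmeas : ∀ q : ℕ, AEMeasurable (fun τ => {τ' : ℝ | (2 : ℝ≥0∞) ^ q ≤ dissipationWavenumber c ν (u τ')}.indicator
        (fun τ' => (2 : ℝ≥0∞) ^ q * eLpNorm (blockFn (q : ℤ) (u τ')) ∞ volume) τ) (volume.restrict (Icc s₁ b)))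
    (hM : ∃ M : ℝ≥0∞, M ≠ ∞ ∧ ∀ τ ∈ Icc s₁ b,
      ∑' n : ℕ, (2 : ℝ≥0∞) ^ (((sSup {j : ℕ | IsSaturatedLevel c ν (u τ) j} : ℕ) : ℤ) - n) *
        blockSup (u τ) (((sSup {j : ℕ | IsSaturatedLevel c ν (u τ) j} : ℕ) : ℤ) - n) ≤ M)
    {t : ℝ} (ht : t ∈ Icc s₁ b) :
    (dyadicF (u t)).toReal ≤
      2 * (2 * (dyadicF (u s₁)).toReal * (4 : ℝ) ^ (2 * Bf.toReal * (Mstar.toReal * T))) +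
        (2 * (dyadicF (u s₁)).toReal * (4 : ℝ) ^ (2 * Bf.toReal * (Mstar.toReal * T))) ^ 2 *
          ((20 * K.Cinf) ^ 2 / (c * ν) ^ 2) := by
  obtain ⟨B, hB⟩ := hB
  obtain ⟨M, hMtop, hM⟩ := hM
  have hcν : 0 < c * ν := mul_pos hc hν
  set f : ℝ → ℝ := fun τ => (dyadicF (u τ)).toReal with hf
  set Jt : ℝ → ℕ := fun τ => sSup {j : ℕ | IsSaturatedLevel c ν (u τ) j} with hJt
  set FJ : ℝ → ℝ≥0∞ := fun τ => ∑' n : ℕ, (2 : ℝ≥0∞) ^ (((Jt τ : ℕ) : ℤ) - n) * blockSup (u τ) (((Jt τ : ℕ) : ℤ) - n)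
    with hFJ
  set g : ℕ → ℝ → ℝ≥0∞ := fun q τ => {τ' : ℝ | (2 : ℝ≥0∞) ^ q ≤ dissipationWavenumber c ν (u τ')}.indicator
    (fun τ' => (2 : ℝ≥0∞) ^ q * eLpNorm (blockFn (q : ℤ) (u τ')) ∞ volume) τ with hg
  set ω : ℝ → ℝ → ℝ := fun s t => 2 * (Bf * ∫⁻ τ in Ioc s t, FJ τ).toReal with hω
  set A : ℝ := 2 * f s₁ * (4 : ℝ) ^ (2 * Bf.toReal * (Mstar.toReal * T)) with hA
  set CR : ℝ := (20 * K.Cinf) ^ 2 / (c * ν) ^ 2 with hCR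
  show f t ≤ 2 * A + A ^ 2 * CR
  have hf0 : ∀ τ, 0 ≤ f τ := fun τ => ENNReal.toReal_nonneg
  have hCR0 : 0 ≤ CR := by positivity
  have hA0 : 0 ≤ A := by positivity
  -- Grönwall with the variable rate on `[s₁, b]`
  obtain ⟨hω0, hωeq, hωcont, hω00⟩ := omega_props (a := s₁) (b := b) (Bf := Bf) hMtop hBf hM
  have hgron : ∀ t' ∈ Icc s₁ b, f t' ≤ 2 * f s₁ * (4 : ℝ) ^ (ω s₁ t') := fun t' ht' =>
    le_two_mul_rpow_of_two_point (f := f) (ω := ω) (a := s₁) (b := b) (fun τ _ => hf0 τ) ⟨B, hB⟩ hω0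
      (fun s t u hs hst htu hu => (hωeq s t u hs hst htu hu).le) hωcont (fun s _ _ => hω00 s)
      (fun s t hs hst htb => h2p s ⟨hs, hst.trans htb⟩ t ⟨hst, htb⟩) ht'
  -- the supremum `S`
  set S : ℝ := sSup (f '' Icc s₁ b) with hS
  have hbdd : BddAbove (f '' Icc s₁ b) := ⟨B, by rintro _ ⟨τ, hτ, rfl⟩; exact hB τ hτ⟩
  have hfS : ∀ τ ∈ Icc s₁ b, f τ ≤ S := fun τ hτ => le_csSup hbdd ⟨τ, hτ, rfl⟩
  have hS0 : 0 ≤ S := (hf0 s₁).trans (hfS s₁ ⟨le_rfl, hs₁b⟩)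
  -- top levels along `[s₁, b]`
  set R : ℝ := max 1 (CR * S) with hR
  have hR1 : 1 ≤ R := le_max_left _ _
  have hR0 : 0 ≤ R := zero_le_one.trans hR1
  have htop : ∀ τ ∈ Icc s₁ b, (Jt τ = 0 ∨ IsSaturatedLevel c ν (u τ) (Jt τ)) ∧ (2 : ℝ) ^ (Jt τ) ≤ R := by
    intro τ hτ
    obtain ⟨w, hw, hae⟩ := hrep τ hτ
    have hΛ := dissipationWavenumber_lt_top_of_rep K hcν hw hae
    have hJ := topLevel_sSup hΛ
    refine ⟨hJ.2, ?_⟩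
    rcases hJ.2 with h0 | hsat
    · simp only [hJt] at h0 ⊢; rw [h0, pow_zero]; exact hR1
    · have hF : dyadicF w ≠ ∞ := by rw [← dyadicF_congr_ae hae]; exact dyadicF_ne_top_of_rep K hw hae
      have hsat' : IsSaturatedLevel c ν w (Jt τ) := (isSaturatedLevel_congr_ae hae _).1 hsat
      have h1 := two_pow_le_of_isSaturatedLevel K hcν hw hF hsat'
      rw [← dyadicF_congr_ae hae] at h1
      refine h1.trans ((?_ : (20 * (K.Cinf : ℝ)) ^ 2 * f τ / (c * ν) ^ 2 ≤ CR * S).trans (le_max_right _ _))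
      rw [hCR, div_mul_eq_mul_div]
      gcongr
      exact hfS τ hτ
  -- the uniform cut `Q_b`
  set Qb : ℕ := Nat.log 2 ⌊R⌋₊ with hQb
  have hfloor : ⌊R⌋₊ ≠ 0 := (Nat.floor_pos.2 hR1).ne'
  have hJQb : ∀ τ ∈ Icc s₁ b, Jt τ ≤ Qb := by
    intro τ hτ
    refine Nat.le_log_of_pow_le one_lt_two (Nat.le_floor ?_)
    push_cast
    exact (htop τ hτ).2
  have h2Qb : (2 : ℝ) ^ Qb ≤ R := by
    have h1 : ((2 ^ Qb : ℕ) : ℝ) ≤ (⌊R⌋₊ : ℝ) := by exact_mod_cast Nat.pow_log_le_self 2 hfloor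
    push_cast at h1
    exact h1.trans (Nat.floor_le hR0)
  -- the low-mode factor: split at `q*`
  have hFJle : ∀ τ ∈ Icc s₁ b, FJ τ ≤ Mstar + ∑ q ∈ Finset.Ioc qs Qb, g q τ := by
    intro τ hτ
    have h1 := lowSum_le_lowSum_add_sum_occupation (v := u τ) (htop τ hτ).1 qs Qb (hJQb τ hτ)
    refine h1.trans (add_le_add (hMstar τ ⟨by linarith [hτ.1], (hτ.2.trans hbT.le)⟩) (le_of_eq ?_))
    refine Finset.sum_congr rfl fun q _ => ?_
    simp only [hg, Set.indicator_apply, Set.mem_setOf_eq]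
  -- the rate integral
  have hIoc : Ioc s₁ b ⊆ Ioo (T / 2) T := fun τ hτ => ⟨by linarith [hτ.1], hτ.2.trans_lt hbT⟩
  have hW : ∀ t' ∈ Icc s₁ b, ∫⁻ τ in Ioc s₁ t', FJ τ ≤ Mstar * ENNReal.ofReal T + Qb * ENNReal.ofReal (2 * c) := by
    intro t' ht'
    calc ∫⁻ τ in Ioc s₁ t', FJ τ ≤ ∫⁻ τ in Ioc s₁ b, FJ τ := lintegral_mono_set (Ioc_subset_Ioc le_rfl ht'.2)
      _ ≤ ∫⁻ τ in Ioc s₁ b, (Mstar + ∑ q ∈ Finset.Ioc qs Qb, g q τ) :=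
          lintegral_mono_ae ((ae_restrict_mem measurableSet_Ioc).mono fun τ hτ => hFJle τ ⟨hτ.1.le, hτ.2⟩)
      _ = Mstar * volume (Ioc s₁ b) + ∑ q ∈ Finset.Ioc qs Qb, ∫⁻ τ in Ioc s₁ b, g q τ := by
          rw [lintegral_add_left measurable_const, setLIntegral_const,
            lintegral_finsetSum' _ fun q _ => (hmeas q).mono_set Ioc_subset_Icc_self]
      _ ≤ Mstar * ENNReal.ofReal T + ∑ _q ∈ Finset.Ioc qs Qb, ENNReal.ofReal (2 * c) := by
          refine add_le_add ?_ (Finset.sum_le_sum fun q hq => (lintegral_mono_set hIoc).trans (hocc q (Finset.mem_Ioc.1 hq).1))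
          rw [Real.volume_Ioc]
          exact mul_le_mul_right (ENNReal.ofReal_le_ofReal (by linarith)) _
      _ ≤ Mstar * ENNReal.ofReal T + Qb * ENNReal.ofReal (2 * c) := by
          rw [Finset.sum_const, Nat.card_Ioc, nsmul_eq_mul]
          gcongr
          exact_mod_cast Nat.sub_le Qb qs
  -- the functional `ω(s₁, t')`
  have hωle : ∀ t' ∈ Icc s₁ b, ω s₁ t' ≤ 2 * Bf.toReal * (Mstar.toReal * T) + 4 * Bf.toReal * c * Qb := by
    intro t' ht'
    have hfin : Mstar * ENNReal.ofReal T + Qb * ENNReal.ofReal (2 * c) ≠ ∞ :=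
      ENNReal.add_ne_top.2 ⟨ENNReal.mul_ne_top hMstar_top ENNReal.ofReal_ne_top,
        ENNReal.mul_ne_top (ENNReal.natCast_ne_top _) ENNReal.ofReal_ne_top⟩
    have h1 := ENNReal.toReal_mono (ENNReal.mul_ne_top hBf hfin) (mul_le_mul_right (hW t' ht') Bf)
    rw [ENNReal.toReal_mul, ENNReal.toReal_mul, ENNReal.toReal_add (ENNReal.mul_ne_top hMstar_top ENNReal.ofReal_ne_top)
      (ENNReal.mul_ne_top (ENNReal.natCast_ne_top _) ENNReal.ofReal_ne_top), ENNReal.toReal_mul, ENNReal.toReal_mul,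
      ENNReal.toReal_ofReal hT.le, ENNReal.toReal_ofReal (by positivity), ENNReal.toReal_natCast] at h1
    simp only [hω]
    rw [ENNReal.toReal_mul]
    linarith [h1]
  -- `f ≤ A (2^{Q_b})^{8 B_f c} ≤ A R^{1/2} ≤ A (1 + √(C_R S))`
  have hθ0 : 0 ≤ 8 * Bf.toReal * c := by positivity
  have hfle : ∀ t' ∈ Icc s₁ b, f t' ≤ A * (1 + Real.sqrt CR * Real.sqrt S) := by
    intro t' ht'
    have h1 := hgron t' ht'
    have h2 : (4 : ℝ) ^ (ω s₁ t') ≤ (4 : ℝ) ^ (2 * Bf.toReal * (Mstar.toReal * T) + 4 * Bf.toReal * c * Qb) :=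
      Real.rpow_le_rpow_of_exponent_le (by norm_num) (hωle t' ht')
    have h3' : (4 : ℝ) ^ (4 * Bf.toReal * c * Qb) = ((2 : ℝ) ^ Qb) ^ (8 * Bf.toReal * c) := by
      have h4Q : (4 : ℝ) ^ Qb = ((2 : ℝ) ^ Qb) ^ ((2 : ℕ) : ℝ) := by
        rw [Real.rpow_natCast, ← pow_mul, show (4 : ℝ) = 2 ^ 2 by norm_num, ← pow_mul, mul_comm]
      rw [show (4 : ℝ) * Bf.toReal * c * Qb = (Qb : ℝ) * (4 * Bf.toReal * c) by ring,
        Real.rpow_mul (by norm_num : (0 : ℝ) ≤ 4), Real.rpow_natCast, h4Q, ← Real.rpow_mul (by positivity)]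
      congr 1; push_cast; ring
    have h3 : (4 : ℝ) ^ (2 * Bf.toReal * (Mstar.toReal * T) + 4 * Bf.toReal * c * Qb) =
        (4 : ℝ) ^ (2 * Bf.toReal * (Mstar.toReal * T)) * ((2 : ℝ) ^ Qb) ^ (8 * Bf.toReal * c) := by
      rw [Real.rpow_add (by norm_num : (0 : ℝ) < 4), h3']
    have h4 : ((2 : ℝ) ^ Qb) ^ (8 * Bf.toReal * c) ≤ R ^ (8 * Bf.toReal * c) :=
      Real.rpow_le_rpow (by positivity) h2Qb hθ0
    have h5 : R ^ (8 * Bf.toReal * c) ≤ R ^ (1 / 2 : ℝ) :=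
      Real.rpow_le_rpow_of_exponent_le hR1 (by linarith)
    have h6 : R ^ (1 / 2 : ℝ) ≤ 1 + Real.sqrt CR * Real.sqrt S := by
      rw [← Real.sqrt_eq_rpow, ← Real.sqrt_mul hCR0]
      calc Real.sqrt R ≤ Real.sqrt (1 + CR * S) := Real.sqrt_le_sqrt (max_le (by nlinarith) (by linarith))
        _ ≤ 1 + Real.sqrt (CR * S) := sqrt_one_add_le (by positivity)
    have h40 : 0 ≤ (4 : ℝ) ^ (2 * Bf.toReal * (Mstar.toReal * T)) := by positivity
    calc f t' ≤ 2 * f s₁ * (4 : ℝ) ^ (ω s₁ t') := h1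
      _ ≤ 2 * f s₁ * ((4 : ℝ) ^ (2 * Bf.toReal * (Mstar.toReal * T)) * ((2 : ℝ) ^ Qb) ^ (8 * Bf.toReal * c)) := by
          rw [← h3]; exact mul_le_mul_of_nonneg_left h2 (by positivity)
      _ = A * ((2 : ℝ) ^ Qb) ^ (8 * Bf.toReal * c) := by rw [hA]; ring
      _ ≤ A * (1 + Real.sqrt CR * Real.sqrt S) := mul_le_mul_of_nonneg_left (h4.trans (h5.trans h6)) hA0
  -- the self-improving inequality for `S`
  have hSle : S ≤ A * (1 + Real.sqrt CR * Real.sqrt S) := by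
    refine csSup_le ⟨f s₁, s₁, ⟨le_rfl, hs₁b⟩, rfl⟩ ?_
    rintro _ ⟨τ, hτ, rfl⟩
    exact hfle τ hτ
  have hamgm : A * (Real.sqrt CR * Real.sqrt S) ≤ (A ^ 2 * CR + S) / 2 := by
    nlinarith [sq_nonneg (A * Real.sqrt CR - Real.sqrt S), Real.sq_sqrt hCR0, Real.sq_sqrt hS0]
  have hSmax : S ≤ 2 * A + A ^ 2 * CR := by nlinarith [hSle, hamgm]
  exact (hfS t ht).trans hSmax

end Covered

end Literature.Analysis.FluidPDE

end
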